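import Summits.BirchSwinnertonDyer.Rank1Residual.WAll.AltClosersCMTwoRamifiedFamilies
import Summits.BirchSwinnertonDyer.Rank1Residual.P2.CongruentNumberGenusDoorsNoGZK
import Summits.BirchSwinnertonDyer.Rank1Residual.P2.CongruentNumberPairsAtTwoTable
import Literature.NumberTheory.EllipticCurves.TianYuanZhang2017.RhoIndexMonskyKernelOdd
import Literature.NumberTheory.EllipticCurves.Tian2014.CMPointSystemGenusBridge
import HarnessLib

/-!
# The TYZρ door with `ρ(n) = 0` READ OFF MONSKY'S KERNEL (certificate-free, flag-free)

Cell `bsd-print-cf2` (D-0131 (2) PRINT TIER), seat p2 («2-descent matrix road»), crux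
`RamifiedOffTYZOfFacts` (stmt-BirchSwinnertonDyer-20509). The flag-free family `CongruentTYZProvedFamily` of the
leaf `WAllCornerFTwoRamifiedTYZProved` (item 20508, CLOSED) contains the TYZρ disjunct: square-free `n ≡ 5, 7 (8)`,
`#Sel₂(E_n) = 8`, **`ρ(n) = 0`** (`(rhoSubgroup n).index = 1`), a genus sum odd — closed modulo
{TYZ Thm 1.2 as printed (`h12`), GZK} by p1's `WAll.PrintCf2.rankOne_sha_bsdp_two_congruentNumberCurve_of_tyzGenus`
and by «bsd-p2»'s `P2.rankOne_sha_bsdp_two_congruentNumberCurve_of_genus_descent` (hypothesis `hρ`). Until now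
the clause `ρ(n) = 0` was discharged per member by a Faulkner–James Laplacian kernel (`n ≡ ±1 (8)` only) or by a
generator certificate. With the tree's NEW `TianYuanZhang2017.RhoMonskyKernel.rhoIndex_eq_one_of_monskyKernel_odd`
(`Literature/…/RhoIndexMonskyKernelOdd.lean`: every kernel vector `(x; y)` of Monsky's matrix with `x + y ∈ {0, 𝟙}`
⟹ `ρ(n) = 0`, rank-free) the door takes a KERNEL-SHAPE hypothesis instead — a finite `𝔽₂`-linear condition
decided by `decide` per member and provable uniformly on families, for every `n (mod 8)`:

* `rankOne_sha_bsdp_two_congruentNumberCurve_of_kerShape` — `n = p₁⋯p_k` (distinct odd primes) `≡ 5, 7 (8)`,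
  Monsky kernel `{0, v}` with `x(v) + y(v) ∈ {0, 𝟙}` (stated: the kernel has `2` elements and every kernel
  vector has that shape), `Σ₁` or `Σ₂′` odd ⟹ `ord_{s=1} L(E_n, s) = 1`, rank `1`, `Ш(E_n)[2^∞] = 0`,
  `BSD(E_n, 2)` — modulo `h12`, `hGZK` ONLY (both conjuncts of the flag-free bundle `𝔅_ram`);
* `cornerFTwo_kerShape` — the same in leaf shape (every globally minimal model, fact-free transport).

HONEST FRAMING: a re-keying of an existing flag-free door (the `ρ = 0` input becomes kernel-decidable); no new
member of the leaf is claimed beyond TYZρ; beyond-print theorem: NO. Census of the crux's residual among the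
`E_n` (categories A/B/C/D, kit job j282439): `HOME/bsd-print-cf2-p2/CENSUS-p2-20509.md`.

## References

* [TianYuanZhang2017] Y. Tian, X. Yuan, S.-W. Zhang, Asian J. Math. 21 (2017) = arXiv:1411.4728, §1 (ρ(n)), Thm. 1.2.
* [HeathBrown1994SelmerCongruentII] D. R. Heath-Brown, Invent. Math. 118 (1994), Appendix (P. Monsky), typescript p. 39.
* [Tian2023CongruentICM] Y. Tian, ICM 2022 survey, Thm. 8 and Thm. 13.
* [Miller2011LMS] R. L. Miller, LMS J. Comput. Math. 14 (2011), Def. 1.1.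
-/

noncomputable section

open scoped Classical

open Matrix WeierstrassCurve Literature.NumberTheory.EllipticCurves
  Literature.NumberTheory.EllipticCurves.Rank1Residual
  Literature.NumberTheory.EllipticCurves.HeathBrown1994
  Literature.NumberTheory.EllipticCurves.TianYuanZhang2017
  Literature.NumberTheory.EllipticCurves.TianYuanZhang2017.RhoMonskyKernel

namespace Summit.BirchSwinnertonDyer.PrintCf2

open Summit.BirchSwinnertonDyer.Rank1Residual Summit.BirchSwinnertonDyer.Rank1Residual.P2

variable {k : ℕ} (p : Fin k → ℕ)

/-- **TYZρ ON KERNEL SHAPE.** For `n = p₁⋯p_k` (distinct odd primes), `n ≡ 5, 7 (mod 8)`, Monsky kernel with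
`2` elements ALL of whose vectors `(x; y)` have `x + y = 0` or `x + y = 𝟙` (⟹ `#Sel₂(E_n) = 8` and `ρ(n) = 0`,
tree theorems), and `Σ₁(n)` or `Σ₂′(n)` odd: `ord_{s=1} L(E_n, s) = 1`, rank `E_n(ℚ) = 1`, `Ш(E_n)[2^∞] = 0` and
`BSD(E_n, 2)` — modulo TYZ Thm 1.2 AS PRINTED (`h12`) and GZK (`hGZK`) only. [cite: TianYuanZhang2017, Thm. 1.2 and §1 (ρ(n))]
[cite: HeathBrown1994SelmerCongruentII, Appendix (Monsky), typescript p. 39 L10–L33]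
[cite: Tian2023CongruentICM, Thm. 8 and Thm. 13] [cite: Miller2011LMS, Def. 1.1] -/
theorem rankOne_sha_bsdp_two_congruentNumberCurve_of_kerShape (h12 : thm12_parity_of_scriptL')
    (hGZK : rank_eq_analyticRank_of_analyticRank_le_one)
    (hp : ∀ i, (p i).Prime) (hodd : ∀ i, Odd (p i)) (hinj : Function.Injective p)
    {n : ℕ} (hn : ∏ i, p i = n) (h8 : n % 8 = 5 ∨ n % 8 = 7)
    (hker : Fintype.card {v : Fin k ⊕ Fin k → ZMod 2 // monskyMatrixOdd p *ᵥ v = 0} = 2)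
    (hshape : ∀ v : Fin k ⊕ Fin k → ZMod 2, monskyMatrixOdd p *ᵥ v = 0 →
      (∀ i, v (Sum.inl i) + v (Sum.inr i) = 0) ∨ ∀ i, v (Sum.inl i) + v (Sum.inr i) = 1)
    (hgen : Odd (genusSum₁ n fun d => genusClassNumber (GenusField d)) ∨
      Odd (genusSum₂' n fun d => genusClassNumber (GenusField d))) :
    haveI := isElliptic_congruentNumberCurve (hn ▸ (squarefree_prod_of_injective p hp hinj).ne_zero)
    (congruentNumberCurve n).analyticRank = 1 ∧ (congruentNumberCurve n).mordellWeilRank = 1 ∧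
      AddCommGroup.primaryComponent (congruentNumberCurve n).sha 2 = ⊥ ∧
      BSDp (congruentNumberCurve n) 2 := by
  have hsq : Squarefree n := hn ▸ squarefree_prod_of_injective p hp hinj
  have hp2 : ∀ i, p i ≠ 2 := fun i h => by
    have := hodd i; rw [h] at this; exact (Nat.not_odd_iff_even.mpr (by decide)) this
  have hs : monskySelmerRankOdd p = 1 := (monskySelmerRankOdd_eq_one_iff_card_ker p).mpr hker
  have hsel : Nat.card ((congruentNumberCurve n).selmerGroup 2) = 8 := by
    subst hn
    rw [monsky_card_selmerGroup_two_odd_holds k p hp hodd hinj, hs]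
    norm_num
  have hρ : (rhoSubgroup n).index = 1 := by
    refine rhoIndex_eq_one_of_monskyKernel_odd hp hp2 hinj (fun x y hxy => ?_) hn
    rcases hshape _ hxy with h | h
    · left; funext i; simpa using h i
    · right; funext i; simpa using h i
  exact WAll.PrintCf2.rankOne_sha_bsdp_two_congruentNumberCurve_of_tyzGenus h12 hGZK hsq h8 hsel hρ hgen

/-- **SLICE TYZρ ON KERNEL SHAPE (leaf shape).** Every globally minimal `ℚ`-model `W` of such an `E_n` satisfies
`BSD(W, 2)`, modulo `h12`, `hGZK` only (fact-free model transport, ty2's interface).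
[cite: TianYuanZhang2017, Thm. 1.2] [cite: Tian2023CongruentICM, Thm. 8 and Thm. 13] [cite: Miller2011LMS, Def. 1.1] -/
theorem cornerFTwo_kerShape (h12 : thm12_parity_of_scriptL')
    (hGZK : rank_eq_analyticRank_of_analyticRank_le_one)
    (hp : ∀ i, (p i).Prime) (hodd : ∀ i, Odd (p i)) (hinj : Function.Injective p)
    {n : ℕ} (hn : ∏ i, p i = n) (h8 : n % 8 = 5 ∨ n % 8 = 7)
    (hker : Fintype.card {v : Fin k ⊕ Fin k → ZMod 2 // monskyMatrixOdd p *ᵥ v = 0} = 2)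
    (hshape : ∀ v : Fin k ⊕ Fin k → ZMod 2, monskyMatrixOdd p *ᵥ v = 0 →
      (∀ i, v (Sum.inl i) + v (Sum.inr i) = 0) ∨ ∀ i, v (Sum.inl i) + v (Sum.inr i) = 1)
    (hgen : Odd (genusSum₁ n fun d => genusClassNumber (GenusField d)) ∨
      Odd (genusSum₂' n fun d => genusClassNumber (GenusField d)))
    (W : WeierstrassCurve ℚ) [W.IsElliptic] [W.IsGloballyMinimal] (C : VariableChange ℚ)
    (hC : C • congruentNumberCurve n = W) : W.analyticRank = 1 ∧ BSDp W 2 := by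
  have hsq : Squarefree n := hn ▸ squarefree_prod_of_injective p hp hinj
  have h := rankOne_sha_bsdp_two_congruentNumberCurve_of_kerShape p h12 hGZK hp hodd hinj hn h8 hker hshape hgen
  exact CornerFTwo.CongruentNumber.analyticRank_eq_one_and_bsdp_two_of_smul hsq ⟨h.1, h.2.2.2⟩ hC

/-- **IN THE CURRENCY OF THE CRUX** (`RamifiedOffTYZOfFacts`' parent bundle `𝔅_ram`, verbatim): granted `𝔅_ram`, every
globally minimal CM curve of analytic rank one that is a `ℚ`-model of an `E_n` with `n = p₁⋯p_k ≡ 5, 7 (8)` (distinct odd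
primes), Monsky kernel `{0, v}` of the torsion shape and a genus sum odd satisfies `BSD(W, 2)` — conjuncts used: GZK (1st)
and TYZ Thm 1.2′ (5th) only. This is the TYZρ sub-slice of the CLOSED item 20508 with its `ρ = 0` clause made
kernel-decidable; it books no new member. [cite: TianYuanZhang2017, Thm. 1.2 and §1 (ρ(n))] [cite: Miller2011LMS, Def. 1.1] -/
theorem ramified_onTYZRhoKerShape_of_bundle :
    (Literature.NumberTheory.EllipticCurves.rank_eq_analyticRank_of_analyticRank_le_one ∧
      WeierstrassCurve.hasEntireLFunction_rat ∧ WeierstrassCurve.bsdRHS_eq_of_isIsogenous ∧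
      Literature.NumberTheory.EllipticCurves.bsdTriple_of_hasCM_of_L_one_ne_zero ∧
      Literature.NumberTheory.EllipticCurves.TianYuanZhang2017.thm12_parity_of_scriptL' ∧
      Literature.NumberTheory.EllipticCurves.Tian2014.thm13_rank_one_and_sha_odd ∧
      Literature.NumberTheory.QuadraticFields.RedeiReichardt.redeiReichardt_fourTwoCard_classGroup ∧
      Literature.NumberTheory.EllipticCurves.LiLiuTian2024.thm12_bsd_congruentNumberCurve ∧
      Literature.NumberTheory.EllipticCurves.Monsky1990.cor515_rank_eq_one_and_card_selmerGroup_two ∧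
      Literature.NumberTheory.EllipticCurves.HeathBrown1994.monsky_card_selmerGroup_two_even ∧
      Literature.NumberTheory.EllipticCurves.Tian2014.tian2014_system_sMinus_genus) →
    ∀ (W : WeierstrassCurve ℚ) [W.IsElliptic] [W.IsGloballyMinimal], W.HasCM → W.analyticRank = 1 →
      ∀ (k : ℕ) (p : Fin k → ℕ), (∀ i, (p i).Prime) → (∀ i, Odd (p i)) → Function.Injective p →
        ((∏ i, p i) % 8 = 5 ∨ (∏ i, p i) % 8 = 7) →
        Fintype.card {v : Fin k ⊕ Fin k → ZMod 2 // monskyMatrixOdd p *ᵥ v = 0} = 2 →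
        (∀ v : Fin k ⊕ Fin k → ZMod 2, monskyMatrixOdd p *ᵥ v = 0 →
          (∀ i, v (Sum.inl i) + v (Sum.inr i) = 0) ∨ ∀ i, v (Sum.inl i) + v (Sum.inr i) = 1) →
        (Odd (genusSum₁ (∏ i, p i) fun d => genusClassNumber (GenusField d)) ∨
          Odd (genusSum₂' (∏ i, p i) fun d => genusClassNumber (GenusField d))) →
        ∀ C : VariableChange ℚ, C • congruentNumberCurve (∏ i, p i) = W → BSDp W 2 := by
  rintro ⟨hGZK, -, -, -, h12, -, -, -, -, -, -⟩ W _ _ _ _ k p hp hodd hinj h8 hker hshape hgen C hC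
  exact (cornerFTwo_kerShape p h12 hGZK hp hodd hinj rfl h8 hker hshape hgen W C hC).2

/-- **TYZρ ON KERNEL SHAPE — TABLE ROUTE** (the signature of «bsd-p2»'s `…_of_genus_descent` with `hρ` replaced
by the kernel shape): the Legendre data supplied as closed tables `L`, `d2 = [(2/pᵢ) ≠ 1]`, `dm2 = [(−2/pᵢ) ≠ 1]`
so that BOTH the kernel count and the kernel shape are decided by `decide` on an explicit `𝔽₂`-matrix per member.
[cite: TianYuanZhang2017, Thm. 1.2 and §1 (ρ(n))] [cite: HeathBrown1994SelmerCongruentII, Appendix (Monsky), typescript p. 39 L27–L33]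
[cite: Miller2011LMS, Def. 1.1] -/
theorem rankOne_sha_bsdp_two_congruentNumberCurve_of_kerShape_table (h12 : thm12_parity_of_scriptL')
    (hGZK : rank_eq_analyticRank_of_analyticRank_le_one)
    (hp : ∀ i, (p i).Prime) (hodd : ∀ i, Odd (p i)) (hinj : Function.Injective p)
    {n : ℕ} (hn : ∏ i, p i = n) (h8 : n % 8 = 5 ∨ n % 8 = 7)
    (L : Fin k → Fin k → ZMod 2) (d2 dm2 : Fin k → ZMod 2)
    (hL : ∀ i j, addLegendreSym (p j) (p i) = L i j) (h2 : ∀ i, addLegendreSym 2 (p i) = d2 i)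
    (hm2 : ∀ i, addLegendreSym (-2) (p i) = dm2 i)
    (hker : Fintype.card {v : Fin k ⊕ Fin k → ZMod 2 // Matrix.fromBlocks
        (Matrix.of (fun i j => if i = j then ∑ l ∈ Finset.univ.erase i, L i l else L i j) +
          Matrix.diagonal d2) (Matrix.diagonal d2) (Matrix.diagonal d2)
        (Matrix.of (fun i j => if i = j then ∑ l ∈ Finset.univ.erase i, L i l else L i j) +
          Matrix.diagonal dm2) *ᵥ v = 0} = 2)
    (hshape : ∀ v : Fin k ⊕ Fin k → ZMod 2, Matrix.fromBlocks
        (Matrix.of (fun i j => if i = j then ∑ l ∈ Finset.univ.erase i, L i l else L i j) +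
          Matrix.diagonal d2) (Matrix.diagonal d2) (Matrix.diagonal d2)
        (Matrix.of (fun i j => if i = j then ∑ l ∈ Finset.univ.erase i, L i l else L i j) +
          Matrix.diagonal dm2) *ᵥ v = 0 →
      (∀ i, v (Sum.inl i) + v (Sum.inr i) = 0) ∨ ∀ i, v (Sum.inl i) + v (Sum.inr i) = 1)
    (hgen : Odd (genusSum₁ n fun d => genusClassNumber (GenusField d)) ∨
      Odd (genusSum₂' n fun d => genusClassNumber (GenusField d))) :
    haveI := isElliptic_congruentNumberCurve (hn ▸ (squarefree_prod_of_injective p hp hinj).ne_zero)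
    (congruentNumberCurve n).analyticRank = 1 ∧ (congruentNumberCurve n).mordellWeilRank = 1 ∧
      AddCommGroup.primaryComponent (congruentNumberCurve n).sha 2 = ⊥ ∧
      BSDp (congruentNumberCurve n) 2 := by
  have e : monskyMatrixOdd p = Matrix.fromBlocks
      (Matrix.of (fun i j => if i = j then ∑ l ∈ Finset.univ.erase i, L i l else L i j) +
        Matrix.diagonal d2) (Matrix.diagonal d2) (Matrix.diagonal d2)
      (Matrix.of (fun i j => if i = j then ∑ l ∈ Finset.univ.erase i, L i l else L i j) +
        Matrix.diagonal dm2) := by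
    simp only [monskyMatrixOdd, legendreMatrix_eq_ofTable p L hL,
      legendreDiagonal_eq_ofTable p 2 d2 h2, legendreDiagonal_eq_ofTable p (-2) dm2 hm2]
  refine rankOne_sha_bsdp_two_congruentNumberCurve_of_kerShape p h12 hGZK hp hodd hinj hn h8 ?_ ?_ hgen
  · rw [e]; exact hker
  · intro v hv; rw [e] at hv; exact hshape v hv

/-- **Instance `n = 39 = 3·13`** (class `7`, `(13/3) = (3/13) = 1`, `(2/3) = (2/13) = −1`, `(−2/3) = 1`,
`(−2/13) = −1`): the table matrix has kernel `{0, ((0,1);(0,1))}` with `x + y = 0` — both kernel hypotheses of the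
table door by `decide`; so `ρ(39) = 0` needs neither a generator nor a Faulkner–James kernel. [cite: TianYuanZhang2017, §1 (ρ(n))] -/
theorem kerShape_table_example_39 :
    Fintype.card {v : Fin 2 ⊕ Fin 2 → ZMod 2 // Matrix.fromBlocks
        (Matrix.of (fun i j => if i = j then ∑ l ∈ Finset.univ.erase i, (0 : Fin 2 → Fin 2 → ZMod 2) i l
          else (0 : Fin 2 → Fin 2 → ZMod 2) i j) + Matrix.diagonal ![1, 1]) (Matrix.diagonal ![1, 1])
        (Matrix.diagonal ![1, 1])
        (Matrix.of (fun i j => if i = j then ∑ l ∈ Finset.univ.erase i, (0 : Fin 2 → Fin 2 → ZMod 2) i l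
          else (0 : Fin 2 → Fin 2 → ZMod 2) i j) + Matrix.diagonal ![0, 1]) *ᵥ v = 0} = 2 ∧
    ∀ v : Fin 2 ⊕ Fin 2 → ZMod 2, Matrix.fromBlocks
        (Matrix.of (fun i j => if i = j then ∑ l ∈ Finset.univ.erase i, (0 : Fin 2 → Fin 2 → ZMod 2) i l
          else (0 : Fin 2 → Fin 2 → ZMod 2) i j) + Matrix.diagonal ![1, 1]) (Matrix.diagonal ![1, 1])
        (Matrix.diagonal ![1, 1])
        (Matrix.of (fun i j => if i = j then ∑ l ∈ Finset.univ.erase i, (0 : Fin 2 → Fin 2 → ZMod 2) i l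
          else (0 : Fin 2 → Fin 2 → ZMod 2) i j) + Matrix.diagonal ![0, 1]) *ᵥ v = 0 →
      (∀ i, v (Sum.inl i) + v (Sum.inr i) = 0) ∨ ∀ i, v (Sum.inl i) + v (Sum.inr i) = 1 := by
  constructor <;> decide

end Summit.BirchSwinnertonDyer.PrintCf2

end
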